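import Summits.BirchSwinnertonDyer.Rank1Residual.AdditivePotMult.RankZeroHeegnerLowerTwist
import Literature.NumberTheory.QuadraticFields.ImaginaryResiduePiForm
import HarnessLib

/-!
# Rank ZERO at an additive prime with `E[p]` irreducible, PER-DATUM certificate kernels: the UPPER half (and, when `#Ш_an(E)` is a
# `p`-unit, `BSD_p(E)` outright) from PUBLISHED theorems + ONE Heegner datum whose rank-one twist has `p`-UNIT analytic Ш

Prover seat `bsd-potss-kmc`, gen 21 (cell `bsd-potss`; the U₀-ns nodes K9 19189 `WildUpperNonsurjTower` / KT 19202
`TameUpperNonsurjTower` and their parents 19197 / 19982; companion of the rank-ONE certificate kernels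
`AdditiveRankOneUnitTwistCertificateKernels.lean`), 2026-08-27. Route-free. HONEST FRAMING: CONDITIONAL on every displayed
hypothesis; 0 definitions, 0 named facts minted, 0 `sorry`; closes nothing (a PER-ROW road books pairs, never a ∀-item); BSD_p
asserted for no explicit curve.

The K9/KT U₀-ns Heegner roads (k9-c4 / k8t-c4: `AdditivePotMult.missingUpperBoundAt_of_heegnerData_of_lowerTwist_rankZero`,
Matar–Nekovář irreducible index bound + Gross–Zagier bookkeeping at a Heegner datum of the rank-ZERO row `E`) consume the LOWER
half `MissingLowerBoundAt (E^{(d_K)}) p` of the rank-ONE twist — an open input (the routes' residuals `TameRankOne` / `WildRankOne`,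
or their L₀). Per row one can CHOOSE the Heegner field so that `ord_p #Ш_an(E^{(d_K)}) ≤ 0` (numeric certificate: `L'(E^{(d)},1)`,
regulator of a saturated generator, periods, Tamagawa numbers — census job of this seat on item 19189); then that LOWER half is
TRIVIAL and the road needs NO rank-one input and NO Coates–Sujatha (A):

* §1 `missingUpperBoundAt_rankZero_irreducible_at_unitTwistDatum_of_matarNekovar` — generic odd additive `p ∣ N`, `E[p]`
  irreducible, `r_an = 0`, `p ∤ ∏c_ℓ(E)`, ONE Heegner datum of level `N(E)` with `d_K` odd `< −4`, Manin constant prime to `p`,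
  a globally minimal model `Wd` of `E^{(d_K)}` with `r_an(Wd) = 1` and `ord_p #Ш_an(Wd) ≤ 0` ⟹ `MissingUpperBoundAt W p`, modulo
  {Gross–Zagier, Kolyvagin, Matar–Nekovář 2019 Thm 0.3 (irreducible form), GZK, modularity} — all PUBLISHED.
* §2 `missingPPartAt_rankZero_irreducible_of_unitShaAn_at_unitTwistDatum_of_matarNekovar`, `bsdp_…` — if moreover
  `ord_p #Ш_an(E) ≤ 0` the LOWER half of `E` is trivial too: `BSD_p(E)` for that PAIR from print + numerics.

NET for the K9/KT tenure (and the b2b residue lane): on the U₀-ns rows with `p ∤ Tam(E)·c(D)` the node's «TameRankOne / WildRankOne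
at twists» input is replaced PER ROW by a numeric unit-twist certificate; where also `p ∤ #Ш_an(E)` the pair's `BSD_p` is print +
numerics. The `p ∣ Tam` rows keep the Jetchev-reading roads (cruxes 20165 / 19941 ff.), which take the same `hlow` and are
discharged the same way.

References: [MatarNekovar2019] Thm. 0.3, §0.11; [GrossZagier1986] Thm. I.6.3, V.§2; [Kolyvagin1990]; [JetchevSkinnerWan2017]
§7.4.1; [Miller2011LMS] Def. 1.1; [SilvermanATAEC1994] Cor. IV.9.2(d).
-/

noncomputable section

open scoped Classical

set_option linter.dupNamespace false
set_option autoImplicit false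

namespace Summit.BirchSwinnertonDyer.BirchSwinnertonDyer.Theorems.AdditiveUnitTwistCertificate

open WeierstrassCurve NumberField Literature.NumberTheory.EllipticCurves
  Literature.NumberTheory.EllipticCurves.ModularForms
  Literature.NumberTheory.EllipticCurves.Rank1Residual
  Literature.NumberTheory.EllipticCurves.Rank1Residual.Typed
  Summit.BirchSwinnertonDyer.Rank1Residual

/-! ## §1 The UPPER half of a rank-zero irreducible additive row from Matar–Nekovář + ONE unit rank-one Heegner twist -/

/-- **UPPER half `ord_p #Ш(E) ≤ ord_p #Ш_an(E)`, rank ZERO, `E[p]` irreducible, additive odd `p`, from PUBLISHED theorems and ONE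
unit-twist Heegner datum.** Data: `W` globally minimal with `p ∣ N(E)` (additive rows), `r_an = 0`, `E[p]` irreducible (any image
size, tower onto or not), `p ∤ ∏c_ℓ(E)`; `K` imaginary quadratic Heegner for `N = N(E)` with `d_K` odd `< −4`; a Heegner datum
`(Dt, H, ι, P)` of level `N` with `p ∤ c(Dt)`; `L(E,1)/Ω_E = q₀ ∈ ℚ`; `Wd` a globally minimal model of `E^{(d_K)}` with `r_an(Wd) = 1`
and `ord_p #Ш_an(Wd) ≤ 0` (numeric certificates). Then `MissingUpperBoundAt W p`, modulo Gross–Zagier, Kolyvagin, Matar–Nekovář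
2019 Thm 0.3 (irreducible, no hypothesis at `p ∣ N`), GZK, modularity — the data-level road
`AdditivePotMult.missingUpperBoundAt_of_heegnerData_of_lowerTwist_rankZero` with `hlow` discharged by the unit certificate
(`ord_p #Ш_an(Wd) ≤ 0 ≤ ord_p #Ш(Wd)`; cf. `UniversalToricDescentWaldspurgerFlat.missingLowerBoundAt_of_shaAn_padicVal_nonpos`) and the
transports `ord_p u(Cd) = 0`, `ord_p ∏c(Wd) = ord_p ∏c(E)` (`p` odd, `p ∣ N` split in `K`, `d_K` odd). CONDITIONAL on the named
facts (hypotheses); closes nothing. [cite: MatarNekovar2019, Thm. 0.3 (p. 456), §0.11 (p. 457)]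
[cite: GrossZagier1986, V.§2 (pp. 310–312)] [cite: JetchevSkinnerWan2017, §7.4.1 (p. 30)] [cite: Miller2011LMS, Def. 1.1] -/
theorem missingUpperBoundAt_rankZero_irreducible_at_unitTwistDatum_of_matarNekovar
    (W : WeierstrassCurve ℚ) [W.IsElliptic] [W.IsGloballyMinimal] (p : ℕ) [Fact p.Prime] (hp2 : p ≠ 2)
    {N : ℕ} [NeZero N] (hN : W.conductorNorm ℤ = N) (hpN : p ∣ N)
    (K : Type) [Field K] [NumberField K]
    (Dt : ModularParametrizationData W N) (H : HeegnerDatum N (NumberField.discr K)) (ι : K →+* ℂ)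
    (P : (W.baseChange K).toAffine.Point)
    (hGZ : gross_zagier N W K) (hKo : kolyvagin N W K)
    (hMN : MatarNekovar2019.thm03_padicValNat_card_sha_le_of_irreducible N W K)
    (hGZK : rank_eq_analyticRank_of_analyticRank_le_one) (hmod : hasEntireLFunction_rat)
    (hK : IsImaginaryQuadratic K) (hHN : SatisfiesHeegnerHypothesis N K)
    (hodd : Odd (NumberField.discr K)) (hd4 : NumberField.discr K < -4)
    (hP : WeierstrassCurve.Affine.Point.map ι.toRatAlgHom P = heegnerPointComplex Dt H)
    (hc : ¬ (p : ℤ) ∣ Dt.c) (hr : W.analyticRank = 0) (hirr : Irr W p) (htam : ¬ p ∣ W.tamagawaProduct)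
    (q0 : ℚ) (hq0 : W.entireLFunction 1 / (W.realPeriodRat : ℂ) = (q0 : ℂ))
    (Wd : WeierstrassCurve ℚ) [Wd.IsElliptic] [Wd.IsGloballyMinimal]
    (hC : ∃ C : VariableChange ℚ, C • W.quadraticTwist (NumberField.discr K : ℚ) = Wd) (hrd : Wd.analyticRank = 1)
    (hunit : ∃ qd : ℚ, shaAn Wd = (qd : ℂ) ∧ padicValRat p qd ≤ 0) :
    MissingUpperBoundAt W p := by
  have hp : p.Prime := Fact.out
  obtain ⟨Cd, hCd⟩ := hC
  have hHN' : SatisfiesHeegnerHypothesis (W.conductorNorm ℤ) K := hN ▸ hHN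
  have hpN' : p ∣ W.conductorNorm ℤ := hN ▸ hpN
  have hD3 : NumberField.discr K ≠ -3 := by omega
  have hD4 : NumberField.discr K ≠ -4 := by omega
  have hμ : ¬ p ∣ Units.torsionOrder K := by
    rw [Literature.NumberTheory.QuadraticFields.Quadratic.torsionOrder_eq_two_of_discr_lt_neg_four hK.1 hd4]
    intro h
    exact hp2 ((Nat.prime_dvd_prime_iff_eq hp Nat.prime_two).mp h)
  have hu : padicValRat p (Cd.u : ℚ) = 0 :=
    AdditivePotMult.padicValRat_u_eq_zero_of_twist_minimal_of_dvd W p K hK hHN' hpN' Cd hCd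
  have hpd : ¬ (p : ℤ) ∣ NumberField.discr K := by
    have := Literature.SatisfiesHeegnerHypothesis.not_dvd_discr hK.1 hHN' hp hpN'
    exact_mod_cast this
  have htamd : ¬ p ∣ Wd.tamagawaProduct := fun h ↦ by
    have h1 := one_le_padicValNat_of_dvd (Wd.tamagawaProduct_pos_holds.ne') h
    rw [X2.padicValNat_tamagawaProduct_twist_of_heegner_of_odd W p hp2 K hK hodd hpd hHN' Cd hCd,
      padicValNat.eq_zero_of_not_dvd htam] at h1
    omega
  exact AdditivePotMult.missingUpperBoundAt_of_heegnerData_of_lowerTwist_rankZero W p N K Dt H ι P hGZ hKo hMN hGZK hmod hK hHN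
    hD3 hD4 hP hp2 hc hμ hr hirr Wd Cd hCd hu hrd q0 hq0 (by obtain ⟨q, hq, hle⟩ := hunit; exact ⟨q, hq, le_trans hle (by exact_mod_cast Nat.zero_le _)⟩) htam htamd

/-! ## §2 When `#Ш_an(E)` is a `p`-unit too: `BSD_p` of the PAIR from print + numerics -/

/-- **`MissingPPartAt W p` (both halves) for a rank-zero irreducible additive row with `p ∤ #Ш_an(E)·∏c_ℓ(E)·c(D)` from PUBLISHED
theorems + ONE unit rank-one Heegner twist**: §1 gives the UPPER half; `ord_p #Ш_an(E) ≤ 0` makes the LOWER half trivial.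
CONDITIONAL on the named facts (hypotheses); a per-ROW statement (books a pair, never a ∀-item).
[cite: MatarNekovar2019, Thm. 0.3 (p. 456), §0.11 (p. 457)] [cite: Miller2011LMS, Def. 1.1] -/
theorem missingPPartAt_rankZero_irreducible_of_unitShaAn_at_unitTwistDatum_of_matarNekovar
    (W : WeierstrassCurve ℚ) [W.IsElliptic] [W.IsGloballyMinimal] (p : ℕ) [Fact p.Prime] (hp2 : p ≠ 2)
    {N : ℕ} [NeZero N] (hN : W.conductorNorm ℤ = N) (hpN : p ∣ N)
    (K : Type) [Field K] [NumberField K]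
    (Dt : ModularParametrizationData W N) (H : HeegnerDatum N (NumberField.discr K)) (ι : K →+* ℂ)
    (P : (W.baseChange K).toAffine.Point)
    (hGZ : gross_zagier N W K) (hKo : kolyvagin N W K)
    (hMN : MatarNekovar2019.thm03_padicValNat_card_sha_le_of_irreducible N W K)
    (hGZK : rank_eq_analyticRank_of_analyticRank_le_one) (hmod : hasEntireLFunction_rat)
    (hK : IsImaginaryQuadratic K) (hHN : SatisfiesHeegnerHypothesis N K)
    (hodd : Odd (NumberField.discr K)) (hd4 : NumberField.discr K < -4)
    (hP : WeierstrassCurve.Affine.Point.map ι.toRatAlgHom P = heegnerPointComplex Dt H)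
    (hc : ¬ (p : ℤ) ∣ Dt.c) (hr : W.analyticRank = 0) (hirr : Irr W p) (htam : ¬ p ∣ W.tamagawaProduct)
    (q0 : ℚ) (hq0 : W.entireLFunction 1 / (W.realPeriodRat : ℂ) = (q0 : ℂ))
    (hunit0 : ∃ q : ℚ, shaAn W = (q : ℂ) ∧ padicValRat p q ≤ 0)
    (Wd : WeierstrassCurve ℚ) [Wd.IsElliptic] [Wd.IsGloballyMinimal]
    (hC : ∃ C : VariableChange ℚ, C • W.quadraticTwist (NumberField.discr K : ℚ) = Wd) (hrd : Wd.analyticRank = 1)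
    (hunit : ∃ qd : ℚ, shaAn Wd = (qd : ℂ) ∧ padicValRat p qd ≤ 0) :
    MissingPPartAt W p :=
  missingPPartAt_of_lower_of_upper W p
    (by obtain ⟨q, hq, hle⟩ := hunit0; exact ⟨q, hq, le_trans hle (by exact_mod_cast Nat.zero_le _)⟩)
    (missingUpperBoundAt_rankZero_irreducible_at_unitTwistDatum_of_matarNekovar W p hp2 hN hpN K Dt H ι P hGZ hKo hMN hGZK hmod
      hK hHN hodd hd4 hP hc hr hirr htam q0 hq0 Wd hC hrd hunit)

/-- **`BSD_p` of the pair** (Miller's `BSD(E,p)`: rank part by GZK, `Ш` finite, `ord_p #Ш = ord_p #Ш_an`) under the hypotheses of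
`missingPPartAt_rankZero_irreducible_of_unitShaAn_at_unitTwistDatum_of_matarNekovar`. CONDITIONAL on the named facts; per row.
[cite: MatarNekovar2019, Thm. 0.3 (p. 456)] [cite: Miller2011LMS, §1 and Def. 1.1] -/
theorem bsdp_rankZero_irreducible_of_unitShaAn_at_unitTwistDatum_of_matarNekovar
    (W : WeierstrassCurve ℚ) [W.IsElliptic] [W.IsGloballyMinimal] (p : ℕ) [Fact p.Prime] (hp2 : p ≠ 2)
    {N : ℕ} [NeZero N] (hN : W.conductorNorm ℤ = N) (hpN : p ∣ N)
    (K : Type) [Field K] [NumberField K]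
    (Dt : ModularParametrizationData W N) (H : HeegnerDatum N (NumberField.discr K)) (ι : K →+* ℂ)
    (P : (W.baseChange K).toAffine.Point)
    (hGZ : gross_zagier N W K) (hKo : kolyvagin N W K)
    (hMN : MatarNekovar2019.thm03_padicValNat_card_sha_le_of_irreducible N W K)
    (hGZK : rank_eq_analyticRank_of_analyticRank_le_one) (hmod : hasEntireLFunction_rat)
    (hK : IsImaginaryQuadratic K) (hHN : SatisfiesHeegnerHypothesis N K)
    (hodd : Odd (NumberField.discr K)) (hd4 : NumberField.discr K < -4)
    (hP : WeierstrassCurve.Affine.Point.map ι.toRatAlgHom P = heegnerPointComplex Dt H)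
    (hc : ¬ (p : ℤ) ∣ Dt.c) (hr : W.analyticRank = 0) (hirr : Irr W p) (htam : ¬ p ∣ W.tamagawaProduct)
    (q0 : ℚ) (hq0 : W.entireLFunction 1 / (W.realPeriodRat : ℂ) = (q0 : ℂ))
    (hunit0 : ∃ q : ℚ, shaAn W = (q : ℂ) ∧ padicValRat p q ≤ 0)
    (Wd : WeierstrassCurve ℚ) [Wd.IsElliptic] [Wd.IsGloballyMinimal]
    (hC : ∃ C : VariableChange ℚ, C • W.quadraticTwist (NumberField.discr K : ℚ) = Wd) (hrd : Wd.analyticRank = 1)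
    (hunit : ∃ qd : ℚ, shaAn Wd = (qd : ℂ) ∧ padicValRat p qd ≤ 0) :
    BSDp W p :=
  bsdp_of_missingPPartAt W p hGZK (by rw [hr]; exact zero_le_one)
    (missingPPartAt_rankZero_irreducible_of_unitShaAn_at_unitTwistDatum_of_matarNekovar W p hp2 hN hpN K Dt H ι P hGZ hKo hMN
      hGZK hmod hK hHN hodd hd4 hP hc hr hirr htam q0 hq0 hunit0 Wd hC hrd hunit)

end Summit.BirchSwinnertonDyer.BirchSwinnertonDyer.Theorems.AdditiveUnitTwistCertificate

end
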